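import Literature.Geometry.Lorentzian.Basic
import Summits.FinalStateConjecture.FinalStateConjecture.Theorems.InertialRecession.Negative.CesaroShadow

/-!
# Negative knowledge for the crux `InertialRecession` (item stmt-FinalStateConjecture-10166), VIII:
# the soft final-motion lemma `stub_expandingChargeKinematics` — witnesses, window bookkeeping, and the statement

Refuter file (D-0016 negative lane, `--supports stmt-FinalStateConjecture-10166`), drefute seat gen 4, line
`old-light-leaves-the-cone` (second lead's skeleton r2, `Cruxes/InertialRecession/Lines/old_light_leaves_the_cone.lean`,
sha256 `0bf5fbfba166…`), stub S4 `stub_expandingChargeKinematics` (Mathlib-only: "expanding system of charges" ⇒ Cesàro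
velocities). No Theses decl is asserted. Contents:

* §1 `E3`-valued witnesses built on the scalar witness `centre` of `KinematicShadow.lean` / `CesaroShadow.lean`:
  `axisCentre = centre (1/4) • e₀` (smooth, eventually in the cone `(1/2)²t`, speed `≤ 1/4`, NO Cesàro velocity) and the
  far world-line `farCentre = (t/2 + centre (1/8) t) • e₀` (speed `≤ 5/8`, norm `≥ 3t/8`, no Cesàro velocity); the exact
  kinematic window charges `kinWindowCharge` (moving unit mass) and `restWindowCharge` (unit mass painted at rest).
* §2 `inside_iff_inside_of_admissible` — POSITIVE and reusable (step (0) of the S4 plan): along a `2`-Lipschitz path of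
  `δ`-admissible windows with `R ≥ R₀ > 0` a continuous world-line is inside the window at `t₁` iff it is inside at `t₂`
  (intermediate value theorem: `‖ξ − c‖ − R` avoids `(−δR, δR)`).
* §3 the stub clause by clause (`S4Cone`, `S4Separation`, `S4SpeedBound`, `S4Slaving`, `S4WindowLaw`, `S4SingleHole`,
  `S4Additivity`, `S4Identification`, `S4Conclusion`), `ExpandingChargeKinematics`, and the faithfulness check
  `expandingChargeKinematics_iff : ExpandingChargeKinematics ↔ <verbatim registered stub> := Iff.rfl`.

The six load-bearing models live in `ExpandingChargeLoadBearing.lean` (next file). Standing disprover's work file: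
`Cruxes/InertialRecession/Disproof.lean` (§H is the mechanism of S4).
-/

set_option linter.dupNamespace false

noncomputable section

namespace Summit.FinalStateConjecture.FinalStateConjecture.Theorems.InertialRecession.Negative

open Filter Set
open scoped Topology
open Literature.Geometry.Lorentzian

/-! ## §1 An `E3`-valued smooth world-line in the cone with no Cesàro velocity -/

/-- The first spatial axis of `E3`. -/
def axis0 : E3 := EuclideanSpace.single (0 : Fin 3) (1 : ℝ)

/-- `‖e₀‖ = 1`. [folklore] -/
@[simp] lemma norm_axis0 : ‖axis0‖ = 1 := by simp [axis0]

/-- The `0`-th coordinate of `e₀` is `1`. [folklore] -/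
@[simp] lemma axis0_apply_zero : axis0 0 = 1 := by simp [axis0]

/-- The witness world-line `t ↦ centre (1/4) t • e₀` (the scalar witness of `KinematicShadow.lean` put on
the first axis): smooth, eventually inside the cone `(1/2)² t`, speed `≤ 1/4`, and `ξ(t)/t` does not
converge (`CesaroShadow.not_tendsto_centre_div`). -/
def axisCentre (t : ℝ) : E3 := centre (1 / 4) t • axis0

/-- Its velocity `t ↦ (cos (log (1 + t²) / 2) / 4) • e₀`. -/
def axisVel (t : ℝ) : E3 := ((1 / 4 : ℝ) * vel t) • axis0

/-- The witness world-line is smooth. [folklore] -/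
lemma contDiff_axisCentre : ContDiff ℝ ((⊤ : ℕ∞) : WithTop ℕ∞) axisCentre :=
  (contDiff_centre _).smul contDiff_const

/-- The witness world-line is continuous. [folklore] -/
lemma continuous_axisCentre : Continuous axisCentre := contDiff_axisCentre.continuous

/-- The witness velocity is continuous. [folklore] -/
lemma continuous_axisVel : Continuous axisVel :=
  (continuous_const.mul continuous_vel).smul continuous_const

/-- The witness world-line has velocity `axisVel`. [folklore] -/
lemma hasDerivAt_axisCentre (t : ℝ) : HasDerivAt axisCentre (axisVel t) t :=
  (hasDerivAt_centre (1 / 4) t).smul_const axis0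

/-- `deriv axisCentre = axisVel`. [folklore] -/
lemma deriv_axisCentre (t : ℝ) : deriv axisCentre t = axisVel t := (hasDerivAt_axisCentre t).deriv

/-- `‖axisCentre t‖ = |centre (1/4) t|`. [folklore] -/
lemma norm_axisCentre (t : ℝ) : ‖axisCentre t‖ = |centre (1 / 4) t| := by
  rw [axisCentre, norm_smul, norm_axis0, mul_one, Real.norm_eq_abs]

/-- Speed bound `‖axisVel t‖ ≤ 1/4`. [folklore] -/
lemma norm_axisVel_le (t : ℝ) : ‖axisVel t‖ ≤ 1 / 4 := by
  rw [axisVel, norm_smul, norm_axis0, mul_one, Real.norm_eq_abs, abs_mul]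
  calc |(1 / 4 : ℝ)| * |vel t| ≤ |(1 / 4 : ℝ)| * 1 :=
      mul_le_mul_of_nonneg_left (abs_vel_le t) (abs_nonneg _)
    _ = 1 / 4 := by norm_num

/-- The witness is eventually inside the cone `(1/2)² t`. [folklore] -/
lemma eventually_norm_axisCentre_le : ∀ᶠ t in atTop, ‖axisCentre t‖ ≤ (1 / 2) ^ 2 * t := by
  filter_upwards [eventually_abs_centre_le] with t ht
  rwa [norm_axisCentre]

/-- The witness has no Cesàro velocity in `E3`. [folklore] -/
theorem not_tendsto_inv_smul_axisCentre :
    ¬ ∃ V : E3, Tendsto (fun t : ℝ ↦ t⁻¹ • axisCentre t) atTop (𝓝 V) := by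
  rintro ⟨V, hV⟩
  refine not_tendsto_centre_div (by norm_num : (1 / 4 : ℝ) ≠ 0) ⟨V 0, ?_⟩
  have h := ((EuclideanSpace.proj (0 : Fin 3)).continuous.tendsto V).comp hV
  refine h.congr fun t ↦ ?_
  simp [axisCentre, div_eq_inv_mul]

/-- The far world-line `t ↦ (t/2 + centre (1/8) t) • e₀`: smooth, speed `≤ 5/8`, norm `≥ 3t/8` for `t ≥ 0`
(outside the middle cone `(κ + κ²)t/2 = 3t/8` of `κ = 1/2`), and `ξ(t)/t` does not converge. -/
def farCentre (t : ℝ) : E3 := (t / 2 + centre (1 / 8) t) • axis0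

/-- Its velocity. -/
def farVel (t : ℝ) : E3 := (1 / 2 + (1 / 8 : ℝ) * vel t) • axis0

/-- The far world-line has velocity `farVel`. [folklore] -/
lemma hasDerivAt_farCentre (t : ℝ) : HasDerivAt farCentre (farVel t) t :=
  (((hasDerivAt_id t).div_const 2).add (hasDerivAt_centre (1 / 8) t)).smul_const axis0 |>.congr_deriv (by
    simp [farVel])

/-- Speed bound `‖farVel t‖ ≤ 5/8`. [folklore] -/
lemma norm_farVel_le (t : ℝ) : ‖farVel t‖ ≤ 5 / 8 := by
  rw [farVel, norm_smul, norm_axis0, mul_one, Real.norm_eq_abs]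
  have := abs_vel_le t
  rw [abs_le] at this ⊢
  constructor <;> nlinarith

/-- The far world-line stays outside the middle cone: `3t/8 ≤ ‖farCentre t‖` for `t ≥ 0`. [folklore] -/
lemma le_norm_farCentre {t : ℝ} (ht : 0 ≤ t) : 3 / 8 * t ≤ ‖farCentre t‖ := by
  rw [farCentre, norm_smul, norm_axis0, mul_one, Real.norm_eq_abs]
  have h := abs_centre_le (1 / 8) t
  rw [abs_of_nonneg ht, abs_le] at h
  norm_num at h
  rw [le_abs]
  left
  linarith [h.1]

/-- The far world-line has no Cesàro velocity. [folklore] -/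
theorem not_tendsto_inv_smul_farCentre :
    ¬ ∃ V : E3, Tendsto (fun t : ℝ ↦ t⁻¹ • farCentre t) atTop (𝓝 V) := by
  rintro ⟨V, hV⟩
  refine not_tendsto_centre_div (by norm_num : (1 / 8 : ℝ) ≠ 0) ⟨V 0 - 1 / 2, ?_⟩
  have h := (((EuclideanSpace.proj (0 : Fin 3)).continuous.tendsto V).comp hV).sub_const (1 / 2)
  refine h.congr' ?_
  filter_upwards [eventually_gt_atTop 0] with t ht
  simp [farCentre, div_eq_inv_mul]
  field_simp
  ring

/-- The kinematic four-momentum `γ(v)(1, v)` of a unit-mass point with velocity `axisVel t`, as a `Fin 4`-vector.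
-/
def kinCharge (t : ℝ) (μ : Fin 4) : ℝ :=
  (√(1 - ‖axisVel t‖ ^ 2))⁻¹ * Fin.cons (α := fun _ : Fin 4 ↦ ℝ) (1 : ℝ) (fun k : Fin 3 ↦ axisVel t k) μ

/-- Energy component of `kinCharge`. [folklore] -/
@[simp] lemma kinCharge_zero (t : ℝ) : kinCharge t 0 = (√(1 - ‖axisVel t‖ ^ 2))⁻¹ := by simp [kinCharge]

/-- Momentum components of `kinCharge`. [folklore] -/
@[simp] lemma kinCharge_succ (t : ℝ) (k : Fin 3) :
    kinCharge t k.succ = (√(1 - ‖axisVel t‖ ^ 2))⁻¹ * axisVel t k := by simp [kinCharge]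

/-- The exact kinematic window charge of ONE unit-mass hole on the world-line `axisCentre`: the charge of the hole if
it is inside the (closed) window, else `0`. -/
def kinWindowCharge (t : ℝ) (c : E3) (R : ℝ) (μ : Fin 4) : ℝ :=
  if ‖axisCentre t - c‖ ≤ R then kinCharge t μ else 0

/-- The kinematic window charge of one unit-mass hole AT REST (`v = 0`, `γ = 1`) on the world-line `axisCentre`:
`(1, 0, 0, 0)` if the hole is inside the closed window, else `0`. -/
def restWindowCharge (t : ℝ) (c : E3) (R : ℝ) (μ : Fin 4) : ℝ :=
  if ‖axisCentre t - c‖ ≤ R then (if μ = 0 then 1 else 0) else 0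

/-! ## §2 Along an admissible window path the inside/outside status of a world-line is constant

Step (0) of the S4 plan ("the inside set `A` is constant along an admissible path"), isolated as a
reusable lemma: positive, Mathlib-only. -/

/-- A function which is `2`-Lipschitz on `[t₁, t₂]` in the path sense of the window law is continuous there.
[folklore] -/
lemma continuousOn_of_pathLipschitz {E : Type*} [NormedAddCommGroup E] {c : ℝ → E} {t₁ t₂ : ℝ}
    (h : ∀ s ∈ Icc t₁ t₂, ∀ s' ∈ Icc t₁ t₂, ‖c s - c s'‖ ≤ 2 * |s - s'|) :
    ContinuousOn c (Icc t₁ t₂) := by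
  rw [Metric.continuousOn_iff]
  intro s hs ε hε
  refine ⟨ε / 2, by positivity, fun s' hs' hd ↦ ?_⟩
  rw [dist_eq_norm]
  calc ‖c s' - c s‖ ≤ 2 * |s' - s| := h s' hs' s hs
    _ < ε := by rw [Real.dist_eq] at hd; linarith

/-- **Inside/outside is constant along admissible paths.** If `ξ` is continuous, `c, R` are
`2`-Lipschitz on `[t₁, t₂]`, `R ≥ R₀ > 0` there, and at every time of `[t₁, t₂]` the point `ξ s` is either
within `(1 - δ) R s` of `c s` or beyond `(1 + δ) R s` (`δ > 0`), then `ξ` is inside the window at `t₁`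
iff it is inside at `t₂` (intermediate value theorem for `s ↦ ‖ξ s - c s‖ - R s`). [folklore] -/
theorem inside_iff_inside_of_admissible {ξ c : ℝ → E3} {R : ℝ → ℝ} {t₁ t₂ δ R₀ : ℝ}
    (hξ : Continuous ξ) (hδ : 0 < δ) (hR₀ : 0 < R₀) (h12 : t₁ ≤ t₂)
    (hlip : ∀ s ∈ Icc t₁ t₂, ∀ s' ∈ Icc t₁ t₂, ‖c s - c s'‖ ≤ 2 * |s - s'| ∧ |R s - R s'| ≤ 2 * |s - s'|)
    (hadm : ∀ s ∈ Icc t₁ t₂, R₀ ≤ R s ∧ (‖ξ s - c s‖ ≤ (1 - δ) * R s ∨ (1 + δ) * R s ≤ ‖ξ s - c s‖)) :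
    (‖ξ t₁ - c t₁‖ ≤ R t₁ ↔ ‖ξ t₂ - c t₂‖ ≤ R t₂) := by
  set f : ℝ → ℝ := fun s ↦ ‖ξ s - c s‖ - R s with hf
  have hc : ContinuousOn c (Icc t₁ t₂) := continuousOn_of_pathLipschitz fun s hs s' hs' ↦ (hlip s hs s' hs').1
  have hR : ContinuousOn R (Icc t₁ t₂) := by
    refine continuousOn_of_pathLipschitz (E := ℝ) fun s hs s' hs' ↦ ?_
    rw [Real.norm_eq_abs]
    exact (hlip s hs s' hs').2
  have hfc : ContinuousOn f (Icc t₁ t₂) := ((hξ.continuousOn.sub hc).norm).sub hR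
  -- at admissible times `f ≠ 0`, and `f ≤ 0 ↔ inside`
  have hsign : ∀ s ∈ Icc t₁ t₂, f s ≠ 0 := by
    intro s hs h0
    obtain ⟨hRs, hin | hout⟩ := hadm s hs
    · have : δ * R s ≤ 0 := by simp only [hf] at h0; nlinarith
      nlinarith [mul_pos hδ (hR₀.trans_le hRs)]
    · have : δ * R s ≤ 0 := by simp only [hf] at h0; nlinarith
      nlinarith [mul_pos hδ (hR₀.trans_le hRs)]
  have ht₁ : t₁ ∈ Icc t₁ t₂ := left_mem_Icc.mpr h12
  have ht₂ : t₂ ∈ Icc t₁ t₂ := right_mem_Icc.mpr h12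
  constructor
  · intro h1
    by_contra h2
    rw [not_le] at h2
    -- `f t₁ ≤ 0 < f t₂`: a zero in between
    have h0 : (0 : ℝ) ∈ Icc (f t₁) (f t₂) := ⟨by simp only [hf]; linarith, by simp only [hf]; linarith⟩
    obtain ⟨s, hs, hs0⟩ := intermediate_value_Icc h12 hfc h0
    exact hsign s hs hs0
  · intro h2
    by_contra h1
    rw [not_le] at h1
    have h0 : (0 : ℝ) ∈ Icc (f t₂) (f t₁) := ⟨by simp only [hf]; linarith, by simp only [hf]; linarith⟩
    obtain ⟨s, hs, hs0⟩ := intermediate_value_Icc' h12 hfc h0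
    exact hsign s hs hs0

/-! ## §3 The stub, clause by clause, and a faithfulness check -/

section Clauses

variable (N : ℕ) (M : Fin N → ℝ) (ξ v : Fin N → ℝ → E3) (κ : ℝ) (P : ℝ → E3 → ℝ → Fin 4 → ℝ)

/-- Cone clause of S4: every centre is eventually inside the inner cone `κ² t`. [topic: Summits/FinalStateConjecture/FinalStateConjecture — multi-black-hole kinematics, crux InertialRecession, stub S4] -/
def S4Cone : Prop := ∀ i, ∀ᶠ t in atTop, ‖ξ i t‖ ≤ κ ^ 2 * t

/-- Separation clause of S4: pairwise distances tend to infinity. [topic: Summits/FinalStateConjecture/FinalStateConjecture — multi-black-hole kinematics, crux InertialRecession, stub S4] -/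
def S4Separation : Prop := ∀ i j, i ≠ j → Tendsto (fun t ↦ ‖ξ i t - ξ j t‖) atTop atTop

/-- Uniform sub-luminality of the painted velocities. [topic: Summits/FinalStateConjecture/FinalStateConjecture — multi-black-hole kinematics, crux InertialRecession, stub S4] -/
def S4SpeedBound : Prop := ∃ k : ℝ, 0 ≤ k ∧ k < 1 ∧ ∀ i, ∀ᶠ t in atTop, ‖v i t‖ ≤ k

/-- Slaving clause of S4: `ξ̇ᵢ - vᵢ → 0`. [topic: Summits/FinalStateConjecture/FinalStateConjecture — multi-black-hole kinematics, crux InertialRecession, stub S4] -/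
def S4Slaving : Prop := ∀ i, Tendsto (fun t ↦ deriv (ξ i) t - v i t) atTop (𝓝 0)

/-- The WINDOW LAW of S4 (verbatim): along `2`-Lipschitz paths of `δ`-admissible windows in the middle cone the
abstract charge `P` changes by at most `C∫(R⁻² + R^{-7/4}) + η(t₁)`, `η → 0`. [topic: Summits/FinalStateConjecture/FinalStateConjecture — multi-black-hole kinematics, crux InertialRecession, stub S4] -/
def S4WindowLaw : Prop :=
  ∀ δ : ℝ, 0 < δ → δ < 1 → ∃ (C R₀ T : ℝ) (η : ℝ → ℝ), Tendsto η atTop (𝓝 0) ∧ ∀ (t₁ t₂ : ℝ) (c : ℝ → E3) (R : ℝ → ℝ), T ≤ t₁ → t₁ ≤ t₂ → (∀ s ∈ Set.Icc t₁ t₂, ∀ s' ∈ Set.Icc t₁ t₂, ‖c s - c s'‖ ≤ 2 * |s - s'| ∧ |R s - R s'| ≤ 2 * |s - s'|) → (∀ s ∈ Set.Icc t₁ t₂, (R₀ ≤ R s ∧ ‖c s‖ + R s ≤ (κ + κ ^ 2) / 2 * s ∧ ∀ j, ‖ξ j s - c s‖ ≤ (1 - δ) * R s ∨ (1 + δ)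 * R s ≤ ‖ξ j s - c s‖)) → ∀ μ : Fin 4, |P t₂ (c t₂) (R t₂) μ - P t₁ (c t₁) (R t₁) μ| ≤ C * (∫ s in t₁..t₂, ((R s) ^ 2)⁻¹ + ((R s) ^ (7 / 4 : ℝ))⁻¹) + η t₁

/-- SINGLE-HOLE IDENTIFICATION of S4 (verbatim), with its constants exposed: a sphere of radius `R ≥ R₀` about
`ξᵢ(t)` inside the middle cone, all other centres `≥ 3R` away, carries `Mᵢγ(vᵢ)(1, vᵢ)` up to `ζ(t) + C/R`.
[topic: Summits/FinalStateConjecture/FinalStateConjecture — multi-black-hole kinematics, crux InertialRecession, stub S4] -/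
def S4SingleHole (C R₀ T : ℝ) (ζ : ℝ → ℝ) : Prop :=
  ∀ (t : ℝ) (i : Fin N) (R : ℝ), T ≤ t → R₀ ≤ R → ‖ξ i t‖ + R ≤ (κ + κ ^ 2) / 2 * t → (∀ j, j ≠ i → 3 * R ≤ ‖ξ i t - ξ j t‖) → |P t (ξ i t) R 0 - M i * (√(1 - ‖v i t‖ ^ 2))⁻¹| ≤ ζ t + C / R ∧ ∀ k : Fin 3, |P t (ξ i t) R k.succ - M i * (√(1 - ‖v i t‖ ^ 2))⁻¹ * v i t k| ≤ ζ t + C / R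

/-- ADDITIVITY of S4 (verbatim), with its constants exposed. [topic: Summits/FinalStateConjecture/FinalStateConjecture — multi-black-hole kinematics, crux InertialRecession, stub S4] -/
def S4Additivity (C R₀ T : ℝ) (ζ : ℝ → ℝ) : Prop :=
  ∀ (t : ℝ) (c : E3) (R : ℝ) (A : Finset (Fin N)) (ρ : Fin N → ℝ), T ≤ t → R₀ ≤ R → ‖c‖ + R ≤ (κ + κ ^ 2) / 2 * t → (∀ j ∈ A, ‖ξ j t - c‖ ≤ R / 2) → (∀ j ∉ A, 2 * R ≤ ‖ξ j t - c‖) → (∀ j ∈ A, R₀ ≤ ρ j ∧ ρ j ≤ R / 4 ∧ ∀ j', j' ≠ j → 3 * ρ j ≤ ‖ξ j t - ξ j' t‖) → ∀ μ : Fin 4, |P t c R μ - ∑ j ∈ A, P t (ξ j t) (ρ j) μ| ≤ C * (R⁻¹ + ∑ j ∈ A, (ρ j)⁻¹) + ζ t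

/-- IDENTIFICATION clause of S4 (verbatim): single-hole identification and additivity with common constants and
one `ζ → 0`. [topic: Summits/FinalStateConjecture/FinalStateConjecture — multi-black-hole kinematics, crux InertialRecession, stub S4] -/
def S4Identification : Prop :=
  ∃ (C R₀ T : ℝ) (ζ : ℝ → ℝ), Tendsto ζ atTop (𝓝 0) ∧ S4SingleHole N M ξ v κ P C R₀ T ζ ∧ S4Additivity N ξ κ P C R₀ T ζ

/-- Conclusion of S4: every centre has a Cesàro velocity. [topic: Summits/FinalStateConjecture/FinalStateConjecture — multi-black-hole kinematics, crux InertialRecession, stub S4] -/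
def S4Conclusion : Prop := ∀ i : Fin N, ∃ V : E3, Tendsto (fun t : ℝ ↦ t⁻¹ • ξ i t) atTop (𝓝 V)

end Clauses

/-- `stub_expandingChargeKinematics` (S4 of `Cruxes/InertialRecession/Lines/old_light_leaves_the_cone.lean`, r2),
assembled from the named clauses; `expandingChargeKinematics_iff` certifies that it is LITERALLY the registered
statement. [topic: Summits/FinalStateConjecture/FinalStateConjecture — multi-black-hole kinematics, crux InertialRecession] -/
def ExpandingChargeKinematics : Prop :=
  ∀ (N : ℕ) (M : Fin N → ℝ) (ξ v : Fin N → ℝ → E3) (κ : ℝ) (P : ℝ → E3 → ℝ → Fin 4 → ℝ),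
    (∀ i, 0 < M i) → 0 < κ → κ < 1 → (∀ i, ContDiff ℝ ((⊤ : ℕ∞) : WithTop ℕ∞) (ξ i)) →
    S4Cone N ξ κ → S4Separation N ξ → (∀ i, Continuous (v i)) → S4SpeedBound N v → S4Slaving N ξ v →
    S4WindowLaw N ξ κ P → S4Identification N M ξ v κ P → S4Conclusion N ξ

/-- FAITHFULNESS: `ExpandingChargeKinematics` is, by `Iff.rfl`, the verbatim type of the registered stub
`stub_expandingChargeKinematics` (skeleton r2, sha256 `0bf5fbfba166…`). [folklore] -/
theorem expandingChargeKinematics_iff :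
    ExpandingChargeKinematics ↔
    ∀ (N : ℕ) (M : Fin N → ℝ) (ξ v : Fin N → ℝ → E3) (κ : ℝ) (P : ℝ → E3 → ℝ → Fin 4 → ℝ),
      (∀ i, 0 < M i) → 0 < κ → κ < 1 → (∀ i, ContDiff ℝ ((⊤ : ℕ∞) : WithTop ℕ∞) (ξ i)) →
      (∀ i, ∀ᶠ t in atTop, ‖ξ i t‖ ≤ κ ^ 2 * t) →
      (∀ i j, i ≠ j → Tendsto (fun t ↦ ‖ξ i t - ξ j t‖) atTop atTop) →
      (∀ i, Continuous (v i)) → (∃ k : ℝ, 0 ≤ k ∧ k < 1 ∧ ∀ i, ∀ᶠ t in atTop, ‖v i t‖ ≤ k) →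
      (∀ i, Tendsto (fun t ↦ deriv (ξ i) t - v i t) atTop (𝓝 0)) →
      (∀ δ : ℝ, 0 < δ → δ < 1 → ∃ (C R₀ T : ℝ) (η : ℝ → ℝ), Tendsto η atTop (𝓝 0) ∧ ∀ (t₁ t₂ : ℝ) (c : ℝ → E3) (R : ℝ → ℝ), T ≤ t₁ → t₁ ≤ t₂ → (∀ s ∈ Set.Icc t₁ t₂, ∀ s' ∈ Set.Icc t₁ t₂, ‖c s - c s'‖ ≤ 2 * |s - s'| ∧ |R s - R s'| ≤ 2 * |s - s'|) → (∀ s ∈ Set.Icc t₁ t₂, (R₀ ≤ R s ∧ ‖c s‖ + R s ≤ (κ + κ ^ 2) / 2 * s ∧ ∀ j, ‖ξ j s - c s‖ ≤ (1 - δ) * R s ∨ (1 + δ) * R s ≤ ‖ξ j s - c s‖)) → ∀ μ : Fin 4, |P t₂ (c t₂) (R t₂) μ - P t₁ (c t₁) (R t₁) μ| ≤ C * (∫ s in t₁..t₂, ((R s) ^ 2)⁻¹ + ((R s) ^ (7 / 4 : ℝ))⁻¹) + η t₁) →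
      (∃ (C R₀ T : ℝ) (ζ : ℝ → ℝ), Tendsto ζ atTop (𝓝 0) ∧ (∀ (t : ℝ) (i : Fin N) (R : ℝ), T ≤ t → R₀ ≤ R → ‖ξ i t‖ + R ≤ (κ + κ ^ 2) / 2 * t → (∀ j, j ≠ i → 3 * R ≤ ‖ξ i t - ξ j t‖) → |P t (ξ i t) R 0 - M i * (√(1 - ‖v i t‖ ^ 2))⁻¹| ≤ ζ t + C / R ∧ ∀ k : Fin 3, |P t (ξ i t) R k.succ - M i * (√(1 - ‖v i t‖ ^ 2))⁻¹ * v i t k| ≤ ζ t + C / R) ∧ (∀ (t : ℝ) (c : E3) (R : ℝ) (A : Finset (Fin N)) (ρ : Fin N → ℝ), T ≤ t → R₀ ≤ R → ‖c‖ + R ≤ (κ + κ ^ 2) / 2 * t → (∀ j ∈ A, ‖ξ j t - c‖ ≤ R / 2) → (∀ j ∉ A, 2 * R ≤ ‖ξ j t - c‖) → (∀ j ∈ A, R₀ ≤ ρ j ∧ ρ j ≤ R / 4 ∧ ∀ j', j' ≠ j → 3 * ρ j ≤ ‖ξ j t - ξ j' t‖) → ∀ μ : Fin 4, |P t c R μ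 - ∑ j ∈ A, P t (ξ j t) (ρ j) μ| ≤ C * (R⁻¹ + ∑ j ∈ A, (ρ j)⁻¹) + ζ t)) →
      ∀ i : Fin N, ∃ V : E3, Tendsto (fun t : ℝ ↦ t⁻¹ • ξ i t) atTop (𝓝 V) :=
  Iff.rfl

end Summit.FinalStateConjecture.FinalStateConjecture.Theorems.InertialRecession.Negative

end
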